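import Literature.Probability.RandomPlanarGeometry.LoewnerChainProofs
import Mathlib.MeasureTheory.Integral.IntervalIntegral.FundThmCalculus
import Mathlib.Analysis.Calculus.MeanValue
import HarnessLib

/-!
# Identification of Loewner hulls from the flow (Lawler's Lemma 4.3 and Thm. 4.6, uniqueness half)

G. F. Lawler, *Conformally Invariant Processes in the Plane*, AMS (2005), §4.1. In the proof of
Prop. 4.4 (a simple curve has a continuous driving function) two generic steps occur after the
expansion of the maps has produced a RIGHT derivative:

* Lemma 4.3: "Suppose `u : [0, t₀) → ℂ` is a continuous function such that the right derivative
  `u'₊(t)` exists everywhere and is a continuous function of `t`. Then `u'(t) = u'₊(t)`";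
* the identification of the hulls ("The remaining assertions follow from Theorem 4.6"): the
  family of maps solving `ġ_t(z) = 2/(g_t(z) - U_t)` IS the Loewner chain of `U`, i.e. its hulls
  are the sets `{z : T_z ≤ t}` of Thm. 4.6 — by uniqueness of solutions of the ODE, a point whose
  candidate flow lives in `ℍ` up to time `S` is not swallowed (`T_z > S`), and a point whose flow
  hits the driving function at time `τ ≤ S` is (`T_z ≤ τ`).

Both are proved here for the tree's chordal Loewner chain (`LoewnerChain`: `Loewner.IsSolution`,
`Loewner.swallowingTime`, `Loewner.hull W t = {z ∈ ℍ | T_z ≤ t}`):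

* `hasDerivWithinAt_Icc_of_hasDerivWithinAt_Ici` — **Lemma 4.3** on a compact interval: a
  continuous `φ` on `[a, b]` with continuous right derivative `ψ` on `[a, b)` has derivative `ψ`
  within `[a, b]` everywhere (via `φ - ∫ψ` having right derivative `0`,
  `constant_of_has_deriv_right_zero`, and the fundamental theorem of calculus);
* `Loewner.coe_lt_swallowingTime_of_hasDerivWithinAt` — a solution on `[0, S]` with values in
  `ℍ` gives `S < T_z` (the extension criterion `IsSolution.coe_lt_swallowingTime_of_le_norm_sub`);
* `Loewner.swallowingTime_le_of_tendsto` — a solution on `[0, τ)` with `g_t - W_t → 0` as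
  `t ↑ τ` gives `T_z ≤ τ` (uniqueness `IsSolution.eqOn` against the maximal solution);
* `Loewner.hull_eq_of_flow` — **the hull at time `S` of the chain driven by `W` is `K`** as soon
  as a candidate flow `G t z` solves the equation in `ℍ` on `[0, S]` for `z ∈ ℍ ∖ K` and hits the
  driving function at some time `τ_z ∈ (0, S]` for `z ∈ K ⊆ ℍ`.

This is the last step of Loewner's theorem for slits (the maps `g_{γ(0,t]}` of a simple curve
satisfy these hypotheses with `K = γ(0, S]`), independent of how the equation is derived.

## References

* G. F. Lawler (2005), §4.1: Lemma 4.3, Prop. 4.4, Thm. 4.6 [Lawler2005].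
-/

noncomputable section

open Set Filter Metric Complex
open _root_.Topology
open UpperHalfPlane (upperHalfPlaneSet isOpen_upperHalfPlaneSet)
open scoped NNReal

namespace Literature.Probability.RandomPlanarGeometry

/-! ### Lawler's Lemma 4.3 -/

/-- **Lawler's Lemma 4.3** (compact-interval form): if `φ` is continuous on `[a, b]` and has the
RIGHT derivative `ψ(t)` at every `t ∈ [a, b)`, with `ψ` continuous on `[a, b]`, then `φ` has
derivative `ψ(t)` within `[a, b]` at every `t ∈ [a, b]` (two-sided in the interior). Proof:
`φ - ∫_a ψ` has right derivative `0`, hence is constant (`constant_of_has_deriv_right_zero`), and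
`∫_a ψ` is differentiable by the fundamental theorem of calculus. [cite: Lawler2005, Lemma 4.3] -/
theorem hasDerivWithinAt_Icc_of_hasDerivWithinAt_Ici {E : Type*} [NormedAddCommGroup E]
    [NormedSpace ℝ E] [CompleteSpace E] {φ ψ : ℝ → E} {a b : ℝ} (hab : a ≤ b)
    (hφ : ContinuousOn φ (Icc a b)) (hψ : ContinuousOn ψ (Icc a b))
    (hder : ∀ t ∈ Ico a b, HasDerivWithinAt φ (ψ t) (Ici t) t) {t : ℝ} (ht : t ∈ Icc a b) :
    HasDerivWithinAt φ (ψ t) (Icc a b) t := by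
  -- continuous extension of `ψ` to `ℝ`
  set ψ' : ℝ → E := fun x ↦ ψ (projIcc a b hab x) with hψ'
  have hψ'c : Continuous ψ' :=
    hψ.comp_continuous (continuous_subtype_val.comp continuous_projIcc) fun x ↦ (projIcc a b hab x).2
  have hψ'eq : ∀ x ∈ Icc a b, ψ' x = ψ x := fun x hx ↦ by
    simp only [hψ', projIcc_of_mem hab hx]
  -- its primitive
  set Ψ : ℝ → E := fun u ↦ ∫ x in a..u, ψ' x with hΨ
  have hΨd : ∀ u, HasDerivAt Ψ (ψ' u) u := fun u ↦
    intervalIntegral.integral_hasDerivAt_right (hψ'c.intervalIntegrable _ _)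
      (hψ'c.stronglyMeasurableAtFilter _ _) hψ'c.continuousAt
  have hΨc : Continuous Ψ := continuous_iff_continuousAt.2 fun u ↦ (hΨd u).continuousAt
  -- `φ - Ψ` has right derivative `0` on `[a, b)`, hence is constant
  have hD : ∀ x ∈ Ico a b, HasDerivWithinAt (fun u ↦ φ u - Ψ u) 0 (Ici x) x := fun x hx ↦ by
    have := (hder x hx).sub (hΨd x).hasDerivWithinAt
    rwa [hψ'eq x ⟨hx.1, hx.2.le⟩, sub_self] at this
  have hconst := constant_of_has_deriv_right_zero (hφ.sub hΨc.continuousOn) hD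
  -- so `φ = Ψ + c` on `[a, b]`
  have hEq : EqOn φ (fun u ↦ Ψ u + (φ a - Ψ a)) (Icc a b) := fun u hu ↦ by
    have : φ u - Ψ u = φ a - Ψ a := hconst u hu
    rw [← this]; abel
  have h1 : HasDerivWithinAt (fun u ↦ Ψ u + (φ a - Ψ a)) (ψ' t) (Icc a b) t :=
    ((hΨd t).add_const _).hasDerivWithinAt
  rw [hψ'eq t ht] at h1
  exact h1.congr hEq (hEq ht)

namespace Loewner

variable {W : ℝ≥0 → ℝ}

/-! ### Solutions living in `ℍ` up to time `S` -/

/-- A candidate flow solving the Loewner equation on `[0, τ)` with values in `ℍ` is a solution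
in the tree's sense (`IsSolution W z g τ`). [folklore] -/
theorem isSolution_of_hasDerivWithinAt {τ : ℝ≥0} {z : ℂ} {g : ℝ → ℂ} (hg0 : g 0 = z)
    (hder : ∀ t ∈ Ico (0 : ℝ) τ, HasDerivWithinAt g (2 / (g t - W t.toNNReal)) (Ico (0 : ℝ) τ) t)
    (hH : ∀ t ∈ Ico (0 : ℝ) τ, g t ∈ upperHalfPlaneSet) : IsSolution W z g τ := by
  have hdom : {t : ℝ | 0 ≤ t ∧ (t.toNNReal : WithTop ℝ≥0) < (τ : WithTop ℝ≥0)} = Ico (0 : ℝ) τ := by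
    ext t; rw [mem_timeDomain_coe_iff]; rfl
  refine ⟨hg0, ?_, fun t ht0 htτ ↦ ?_⟩
  · intro t ht
    rw [hdom] at ht ⊢
    exact hder t ht
  · have ht : t ∈ Ico (0 : ℝ) τ := by
      rw [← hdom]; exact ⟨ht0, htτ⟩
    intro heq
    have him : (g t).im = 0 := by rw [heq, ofReal_im]
    exact absurd him (ne_of_gt (hH t ht))

/-- **A point whose candidate flow solves the equation in `ℍ` on the closed interval `[0, S]` is
not swallowed by time `S`: `S < T_z`** (the solution stays a positive distance from the real
driving function on the compact interval; extension criterion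
`IsSolution.coe_lt_swallowingTime_of_le_norm_sub`). [cite: Lawler2005, Thm. 4.6 (T_z and H_t)] -/
theorem coe_lt_swallowingTime_of_hasDerivWithinAt (hW : Continuous W) {S : ℝ≥0} (hS : 0 < S)
    {z : ℂ} {g : ℝ → ℂ} (hg0 : g 0 = z)
    (hder : ∀ t ∈ Icc (0 : ℝ) S, HasDerivWithinAt g (2 / (g t - W t.toNNReal)) (Icc (0 : ℝ) S) t)
    (hH : ∀ t ∈ Icc (0 : ℝ) S, g t ∈ upperHalfPlaneSet) :
    (S : WithTop ℝ≥0) < swallowingTime W z := by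
  have hsol : IsSolution W z g S :=
    isSolution_of_hasDerivWithinAt hg0 (fun t ht ↦ (hder t ⟨ht.1, ht.2.le⟩).mono Ico_subset_Icc_self)
      fun t ht ↦ hH t ⟨ht.1, ht.2.le⟩
  -- the positive distance to the driving function on `[0, S]`
  have hgc : ContinuousOn g (Icc (0 : ℝ) S) := fun t ht ↦ (hder t ht).continuousWithinAt
  have hfc : ContinuousOn (fun t : ℝ ↦ ‖g t - W t.toNNReal‖) (Icc (0 : ℝ) S) :=
    (hgc.sub ((Complex.continuous_ofReal.comp (hW.comp continuous_real_toNNReal)).continuousOn)).norm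
  obtain ⟨t₀, ht₀, hmin⟩ := (isCompact_Icc (a := (0 : ℝ)) (b := S)).exists_isMinOn ⟨0, by simp⟩ hfc
  have hpos : 0 < ‖g t₀ - W t₀.toNNReal‖ := by
    refine norm_pos_iff.2 (sub_ne_zero.2 fun heq ↦ ?_)
    have him : (g t₀).im = 0 := by rw [heq, ofReal_im]
    exact absurd him (ne_of_gt (hH t₀ ht₀))
  exact hsol.coe_lt_swallowingTime_of_le_norm_sub hW hS (δ := ⟨_, hpos.le⟩) hpos
    fun t ht0 htS ↦ hmin (show t ∈ Icc (0 : ℝ) S from ⟨ht0, htS.le⟩)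

/-! ### Solutions hitting the driving function -/

/-- **A point whose flow hits the driving function at time `τ` is swallowed by `τ`: `T_z ≤ τ`.**
If `g` solves the equation on `[0, τ)` (`τ > 0`) and `g_t - W_t → 0` as `t ↑ τ`, then no solution
lives beyond `τ`: the maximal solution would agree with `g` before `τ` (uniqueness,
`IsSolution.eqOn`) and be continuous at `τ` with the forbidden value `W_τ`.
[cite: Lawler2005, Thm. 4.6 (T_z)] -/
theorem swallowingTime_le_of_tendsto (hW : Continuous W) {τ : ℝ≥0} (hτ : 0 < τ) {z : ℂ}
    (hz : z ≠ W 0) {g : ℝ → ℂ} (hsol : IsSolution W z g τ)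
    (hlim : Tendsto (fun t : ℝ ↦ g t - W t.toNNReal) (𝓝[<] (τ : ℝ)) (𝓝 0)) :
    swallowingTime W z ≤ τ := by
  by_contra hcon
  push Not at hcon
  obtain ⟨G, hG⟩ := exists_isSolution_swallowingTime_holds hW hz
  have hτ' : (0 : ℝ) < τ := hτ
  -- `g = G` on `(0, τ)`
  have hEq : ∀ t ∈ Ioo (0 : ℝ) τ, g t = G t := fun t ht ↦ by
    refine IsSolution.eqOn_holds hW hsol hG ⟨ht.1.le, ?_⟩
    rw [lt_min_iff]
    have h1 : (t.toNNReal : WithTop ℝ≥0) < (τ : WithTop ℝ≥0) := (mem_timeDomain_coe_iff.2 ⟨ht.1.le, ht.2⟩).2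
    exact ⟨h1, h1.trans hcon⟩
  -- `G` is continuous at `τ` within its time domain, which contains `(0, τ]`
  have hτdom : (τ : ℝ) ∈ {t : ℝ | 0 ≤ t ∧ (t.toNNReal : WithTop ℝ≥0) < swallowingTime W z} :=
    ⟨hτ'.le, by simpa using hcon⟩
  have hGc : ContinuousWithinAt G {t : ℝ | 0 ≤ t ∧ (t.toNNReal : WithTop ℝ≥0) < swallowingTime W z} τ :=
    hG.continuousOn τ hτdom
  have hsub : Ioo (0 : ℝ) τ ⊆ {t : ℝ | 0 ≤ t ∧ (t.toNNReal : WithTop ℝ≥0) < swallowingTime W z} :=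
    fun t ht ↦ ⟨ht.1.le, ((mem_timeDomain_coe_iff (b := τ)).2 ⟨ht.1.le, ht.2⟩).2.trans hcon⟩
  have h1 : Tendsto G (𝓝[<] (τ : ℝ)) (𝓝 (G τ)) := by
    rw [← nhdsWithin_Ioo_eq_nhdsLT hτ']
    exact hGc.tendsto.mono_left (nhdsWithin_mono _ hsub)
  have h2 : Tendsto g (𝓝[<] (τ : ℝ)) (𝓝 (G τ)) := by
    refine h1.congr' ?_
    rw [← nhdsWithin_Ioo_eq_nhdsLT hτ']
    filter_upwards [self_mem_nhdsWithin] with t ht using (hEq t ht).symm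
  -- but `g t → W τ`
  have hWc : Tendsto (fun t : ℝ ↦ ((W t.toNNReal : ℝ) : ℂ)) (𝓝[<] (τ : ℝ)) (𝓝 (W τ : ℂ)) := by
    have hc : Continuous fun t : ℝ ↦ ((W t.toNNReal : ℝ) : ℂ) :=
      Complex.continuous_ofReal.comp (hW.comp continuous_real_toNNReal)
    have := hc.tendsto (τ : ℝ)
    simp only [Real.toNNReal_coe] at this
    exact this.mono_left nhdsWithin_le_nhds
  have h3 : Tendsto g (𝓝[<] (τ : ℝ)) (𝓝 (0 + (W τ : ℂ))) := by
    have := hlim.add hWc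
    simpa using this
  rw [zero_add] at h3
  have heq : G τ = W τ := tendsto_nhds_unique h2 h3
  have hne := hG.ne hτ'.le (by simpa using hcon)
  rw [Real.toNNReal_coe] at hne
  exact hne heq

/-! ### The hull from the flow -/

/-- **Identification of the Loewner hull from a candidate flow** (Lawler (2005), proof of
Prop. 4.4 via Thm. 4.6): let `W` be continuous, `S > 0`, `K ⊆ ℍ`, and `G : ℝ → ℂ → ℂ` with
`G 0 z = z` such that (i) for `z ∈ ℍ ∖ K`, `t ↦ G t z` solves `ġ = 2/(g - W_t)` within `[0, S]`
with values in `ℍ`, and (ii) for `z ∈ K` there is `τ ∈ (0, S]` such that `t ↦ G t z` is a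
solution on `[0, τ)` with `G t z - W_t → 0` as `t ↑ τ`. Then the hull of the chain driven by `W`
at time `S` is `K`. [cite: Lawler2005, Prop. 4.4 and Thm. 4.6] -/
theorem hull_eq_of_flow (hW : Continuous W) {S : ℝ≥0} (hS : 0 < S) {K : Set ℂ}
    (hK : K ⊆ upperHalfPlaneSet) {G : ℝ → ℂ → ℂ} (hG0 : ∀ z, G 0 z = z)
    (hout : ∀ z ∈ upperHalfPlaneSet \ K,
      (∀ t ∈ Icc (0 : ℝ) S, HasDerivWithinAt (fun s ↦ G s z) (2 / (G t z - W t.toNNReal)) (Icc (0 : ℝ) S) t) ∧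
        ∀ t ∈ Icc (0 : ℝ) S, G t z ∈ upperHalfPlaneSet)
    (hin : ∀ z ∈ K, ∃ τ : ℝ≥0, 0 < τ ∧ τ ≤ S ∧ IsSolution W z (fun s ↦ G s z) τ ∧
      Tendsto (fun t : ℝ ↦ G t z - W t.toNNReal) (𝓝[<] (τ : ℝ)) (𝓝 0)) :
    hull W S = K := by
  ext z
  constructor
  · rintro ⟨hzH, hzT⟩
    by_contra hzK
    obtain ⟨hder, hH⟩ := hout z ⟨hzH, hzK⟩
    exact absurd hzT (not_le.2 (coe_lt_swallowingTime_of_hasDerivWithinAt hW hS (hG0 z) hder hH))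
  · intro hzK
    obtain ⟨τ, hτ, hτS, hsol, hlim⟩ := hin z hzK
    have hzW : z ≠ W 0 := fun heq ↦ by
      have him : z.im = 0 := by rw [heq, ofReal_im]
      exact absurd him (ne_of_gt (hK hzK))
    refine ⟨hK hzK, (swallowingTime_le_of_tendsto hW hτ hzW hsol hlim).trans ?_⟩
    exact_mod_cast hτS

end Loewner

end Literature.Probability.RandomPlanarGeometry
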